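import Summits.Ventures.PercRepro.C041ZonePortCaseII

/-!
# The zone port problem of THEOREM R: CASE (iv), gates of both pure types, and the four-way split (p6, gen 24)

Setting of `C041ZonePortDefs` / `C041ZonePortCaseII` (mine-3, C-041.md §3 (iv) / §6 (c), general multiplicities).  A
zone is of PURE TYPE `{1}` (`Pure₁`) when it carries 1-edges only, of pure type `{2}` (`Pure₂`) when 2-edges only; a
pure-type gate is never deleted on the side it does not carry, so a red edge at it gives the opposite side by THE
KEY FACT (`good₂_of_red_pure_gate`, `good₁_of_red_pure_gate`).  The paper's count for case (iv) is a charging of the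
CLOSED colouring of two terminal edges `e, f` at pure-type gates:

* **both types present** (`phi_nonneg_of_pure_gates_mixed`): `e` a 1-edge at a gate of type `{1}`, `f` a 2-edge at a
  gate of type `{2}`; the patterns with `e, f` red have weight `4`, those with one of them red weight `≥ 1`, the
  closed one `≥ −2` and it injects into the first class by reddening both edges;
* two edges of the same side at pure-type gates (possibly the same gate): `C041ZonePortCaseIVB`.

Together with cases (ii), (iii) this leaves, for THE LEMMA, exactly case (v): a UNIQUE gate, switchable, of pure type,
carrying a SINGLE terminal edge.  Both results hold for any validity predicate kept by reddening one edge.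
-/

namespace PercRepro

namespace ZonePort

namespace Problem

open Finset

variable {V E : Type*} {P : Problem V E}

/-- A zone of pure type `{1}`: it carries 1-edges only. -/
def Pure₁ (P : Problem V E) (C : Finset V) : Prop := ∀ f : P.Term, P.tz f.1 = C → P.ts f.1 = false

/-- A zone of pure type `{2}`: it carries 2-edges only. -/
def Pure₂ (P : Problem V E) (C : Finset V) : Prop := ∀ f : P.Term, P.tz f.1 = C → P.ts f.1 = true

/-- **A red 1-edge at a type-`{1}` gate gives `Good₂`.** -/
theorem good₂_of_red_pure_gate {x : P.Term → Bool} {e : P.Term} (hC : P.IsGate (P.tz e.1))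
    (he : P.ts e.1 = false) (hp : P.Pure₁ (P.tz e.1)) (hx : x e = true) : P.Good₂ x :=
  good₂_of_red_gate hC he hx fun f hf hfs => by
    have := hp f hf
    rw [hfs] at this
    exact Bool.noConfusion this

/-- **A red 2-edge at a type-`{2}` gate gives `Good₁`.** -/
theorem good₁_of_red_pure_gate {x : P.Term → Bool} {e : P.Term} (hC : P.IsGate (P.tz e.1))
    (he : P.ts e.1 = true) (hp : P.Pure₂ (P.tz e.1)) (hx : x e = true) : P.Good₁ x :=
  good₁_of_red_gate hC he hx fun f hf hfs => by
    have := hp f hf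
    rw [hfs] at this
    exact Bool.noConfusion this

section Update

variable [DecidableEq E]

/-- Reddening one edge keeps admissibility. -/
theorem adm_update_true {x : P.Term → Bool} (hx : P.Adm x) (e : P.Term) :
    P.Adm (Function.update x e true) := by
  refine ⟨fun f hf => ?_, fun f g hfg hf hg => ?_⟩
  · by_cases hfe : f = e
    · rw [hfe, Function.update_self]
    · rw [Function.update_of_ne hfe]
      exact hx.1 f hf
  · rcases hx.2 f g hfg hf hg with h | h
    · left
      by_cases hfe : f = e
      · rw [hfe, Function.update_self]
      · rw [Function.update_of_ne hfe]
        exact h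
    · right
      by_cases hge : g = e
      · rw [hge, Function.update_self]
      · rw [Function.update_of_ne hge]
        exact h

/-- Reddening one edge keeps `X₁`. -/
theorem X₁_update_true {x : P.Term → Bool} (hx : P.X₁ x) (e : P.Term) :
    P.X₁ (Function.update x e true) := by
  obtain ⟨f, hf, hxf⟩ := hx
  refine ⟨f, hf, ?_⟩
  by_cases hfe : f = e
  · rw [hfe, Function.update_self]
  · rw [Function.update_of_ne hfe]
    exact hxf

/-- Reddening one edge keeps `X₂`. -/
theorem X₂_update_true {x : P.Term → Bool} (hx : P.X₂ x) (e : P.Term) :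
    P.X₂ (Function.update x e true) := by
  obtain ⟨f, hf, hxf⟩ := hx
  refine ⟨f, hf, ?_⟩
  by_cases hfe : f = e
  · rw [hfe, Function.update_self]
  · rw [Function.update_of_ne hfe]
    exact hxf

/-- `Function.update` at `e` is injective on the functions with a common value at `e`. -/
theorem update_injOn {α β : Type*} [DecidableEq α] (e : α) (b v : β) :
    Set.InjOn (fun x : α → β => Function.update x e b) {x | x e = v} := by
  intro x hx y hy hxy
  funext f
  by_cases hfe : f = e
  · rw [hfe]
    exact hx.trans hy.symm
  · have := congrFun hxy f
    simp only [Function.update_of_ne hfe] at this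
    exact this

/-- Reddening two edges is injective on the patterns with common values at both. -/
theorem update2_injOn (e f : P.Term) (v w : Bool) :
    Set.InjOn (fun x : P.Term → Bool => Function.update (Function.update x e true) f true)
      {x | x e = v ∧ x f = w} := by
  intro x hx y hy hxy
  funext g
  by_cases hgf : g = f
  · rw [hgf]
    exact hx.2.trans hy.2.symm
  · by_cases hge : g = e
    · rw [hge]
      exact hx.1.trans hy.1.symm
    · have := congrFun hxy g
      simp only [Function.update_of_ne hgf, Function.update_of_ne hge] at this
      exact this

/-- Validity `X₁ ∨ X₂` is kept by reddening one edge. -/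
theorem valOr_update (x : P.Term → Bool) (e : P.Term) (h : P.X₁ x ∨ P.X₂ x) :
    P.X₁ (Function.update x e true) ∨ P.X₂ (Function.update x e true) :=
  h.elim (fun h' => Or.inl (X₁_update_true h' e)) (fun h' => Or.inr (X₂_update_true h' e))

/-- Validity `X₁ ∧ X₂` is kept by reddening one edge. -/
theorem valAnd_update (x : P.Term → Bool) (e : P.Term) (h : P.X₁ x ∧ P.X₂ x) :
    P.X₁ (Function.update x e true) ∧ P.X₂ (Function.update x e true) :=
  ⟨X₁_update_true h.1 e, X₂_update_true h.2 e⟩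

end Update

section Sums

variable [Fintype E] [DecidableEq E] [DecidableEq V]

open Classical in
/-- The four-way split of the pattern sum along two distinct terminal edges `e, f`. -/
theorem sum_split_four (val : (P.Term → Bool) → Prop) (e f : P.Term) :
    (∑ x : P.Term → Bool, if P.Adm x ∧ val x then P.weight x else 0) =
      ∑ x ∈ (univ.filter fun x : P.Term → Bool => (P.Adm x ∧ val x) ∧ x e = true ∧ x f = true),
          P.weight x +
        ∑ x ∈ (univ.filter fun x : P.Term → Bool => (P.Adm x ∧ val x) ∧ x e = true ∧ x f = false),
          P.weight x +
        ∑ x ∈ (univ.filter fun x : P.Term → Bool => (P.Adm x ∧ val x) ∧ x e = false ∧ x f = true),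
          P.weight x +
        ∑ x ∈ (univ.filter fun x : P.Term → Bool => (P.Adm x ∧ val x) ∧ x e = false ∧ x f = false),
          P.weight x := by
  set S := (univ : Finset (P.Term → Bool)).filter fun x => P.Adm x ∧ val x with hS
  have h1 : (S.filter fun x => x e = true).filter (fun x => x f = true) =
      univ.filter fun x : P.Term → Bool => (P.Adm x ∧ val x) ∧ x e = true ∧ x f = true := by
    ext x
    simp only [hS, mem_filter, mem_univ, true_and, and_assoc]
  have h2 : (S.filter fun x => x e = true).filter (fun x => ¬ x f = true) =
      univ.filter fun x : P.Term → Bool => (P.Adm x ∧ val x) ∧ x e = true ∧ x f = false := by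
    ext x
    simp only [hS, mem_filter, mem_univ, true_and, and_assoc, Bool.not_eq_true]
  have h3 : (S.filter fun x => ¬ x e = true).filter (fun x => x f = true) =
      univ.filter fun x : P.Term → Bool => (P.Adm x ∧ val x) ∧ x e = false ∧ x f = true := by
    ext x
    simp only [hS, mem_filter, mem_univ, true_and, and_assoc, Bool.not_eq_true]
  have h4 : (S.filter fun x => ¬ x e = true).filter (fun x => ¬ x f = true) =
      univ.filter fun x : P.Term → Bool => (P.Adm x ∧ val x) ∧ x e = false ∧ x f = false := by
    ext x
    simp only [hS, mem_filter, mem_univ, true_and, and_assoc, Bool.not_eq_true]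
  rw [← Finset.sum_filter, ← hS, ← Finset.sum_filter_add_sum_filter_not S (fun x => x e = true),
    ← Finset.sum_filter_add_sum_filter_not (S.filter fun x => x e = true) (fun x => x f = true),
    ← Finset.sum_filter_add_sum_filter_not (S.filter fun x => ¬ x e = true) (fun x => x f = true),
    h1, h2, h3, h4, add_assoc, add_assoc, add_assoc]

open Classical in
/-- **CASE (iv), both pure types present**: a 1-edge `e` at a gate of type `{1}` and a 2-edge `f` at a gate of type
`{2}` give `0 ≤ Φ`. -/
theorem phi_nonneg_of_pure_gates_mixed (val : (P.Term → Bool) → Prop)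
    (hval : ∀ x e, val x → val (Function.update x e true))
    {e f : P.Term} (hCe : P.IsGate (P.tz e.1)) (hCf : P.IsGate (P.tz f.1))
    (he : P.ts e.1 = false) (hf : P.ts f.1 = true)
    (hpe : P.Pure₁ (P.tz e.1)) (hpf : P.Pure₂ (P.tz f.1)) :
    0 ≤ ∑ x : P.Term → Bool, if P.Adm x ∧ val x then P.weight x else 0 := by
  rw [sum_split_four val e f]
  set RR := univ.filter fun x : P.Term → Bool => (P.Adm x ∧ val x) ∧ x e = true ∧ x f = true with hRR
  set RB := univ.filter fun x : P.Term → Bool => (P.Adm x ∧ val x) ∧ x e = true ∧ x f = false with hRB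
  set BR := univ.filter fun x : P.Term → Bool => (P.Adm x ∧ val x) ∧ x e = false ∧ x f = true with hBR
  set BB := univ.filter fun x : P.Term → Bool => (P.Adm x ∧ val x) ∧ x e = false ∧ x f = false with hBB
  have hne : e ≠ f := by
    intro h
    rw [h] at he
    rw [he] at hf
    exact Bool.noConfusion hf
  have hRRw : 4 * (RR.card : ℤ) ≤ ∑ x ∈ RR, P.weight x := by
    apply card_mul_le_sum_of_forall
    intro x hx
    rw [hRR, mem_filter] at hx
    rw [weight_eq_four_of_good (good₁_of_red_pure_gate hCf hf hpf hx.2.2.2)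
      (good₂_of_red_pure_gate hCe he hpe hx.2.2.1)]
  have hRBw : 1 * (RB.card : ℤ) ≤ ∑ x ∈ RB, P.weight x := by
    apply card_mul_le_sum_of_forall
    intro x hx
    rw [hRB, mem_filter] at hx
    exact one_le_weight_of_good (Or.inr (good₂_of_red_pure_gate hCe he hpe hx.2.2.1))
  have hBRw : 1 * (BR.card : ℤ) ≤ ∑ x ∈ BR, P.weight x := by
    apply card_mul_le_sum_of_forall
    intro x hx
    rw [hBR, mem_filter] at hx
    exact one_le_weight_of_good (Or.inl (good₁_of_red_pure_gate hCf hf hpf hx.2.2.2))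
  have hBBw : -2 * (BB.card : ℤ) ≤ ∑ x ∈ BB, P.weight x :=
    card_mul_le_sum_of_forall fun x _ => neg_two_le_weight x
  have hBBc : BB.card ≤ RR.card := by
    refine card_le_card_of_injOn
      (fun x => Function.update (Function.update x e true) f true) ?_ ?_
    · intro x hx
      rw [hBB, coe_filter] at hx
      rw [hRR, coe_filter]
      refine ⟨mem_univ _, ⟨adm_update_true (adm_update_true hx.2.1.1 e) f,
        hval _ f (hval x e hx.2.1.2)⟩, ?_, ?_⟩
      · show Function.update (Function.update x e true) f true e = true
        rw [Function.update_of_ne hne]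
        exact Function.update_self ..
      · show Function.update (Function.update x e true) f true f = true
        exact Function.update_self ..
    · intro x hx y hy hxy
      rw [hBB, coe_filter] at hx hy
      exact update2_injOn e f false false ⟨hx.2.2.1, hx.2.2.2⟩ ⟨hy.2.2.1, hy.2.2.2⟩ hxy
  have hc : (BB.card : ℤ) ≤ RR.card := by exact_mod_cast hBBc
  linarith

open Classical in
/-- **CASE (iv), `Φ∨`, both pure types present.** -/
theorem phiOr_nonneg_of_pure_gates_mixed {e f : P.Term} (hCe : P.IsGate (P.tz e.1)) (hCf : P.IsGate (P.tz f.1))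
    (he : P.ts e.1 = false) (hf : P.ts f.1 = true) (hpe : P.Pure₁ (P.tz e.1)) (hpf : P.Pure₂ (P.tz f.1)) :
    0 ≤ P.phiOr := by
  unfold phiOr
  convert phi_nonneg_of_pure_gates_mixed (fun x => P.X₁ x ∨ P.X₂ x) valOr_update hCe hCf he hf hpe hpf using 3

open Classical in
/-- **CASE (iv), `Φ∧`, both pure types present.** -/
theorem phiAnd_nonneg_of_pure_gates_mixed {e f : P.Term} (hCe : P.IsGate (P.tz e.1)) (hCf : P.IsGate (P.tz f.1))
    (he : P.ts e.1 = false) (hf : P.ts f.1 = true) (hpe : P.Pure₁ (P.tz e.1)) (hpf : P.Pure₂ (P.tz f.1)) :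
    0 ≤ P.phiAnd := by
  unfold phiAnd
  convert phi_nonneg_of_pure_gates_mixed (fun x => P.X₁ x ∧ P.X₂ x) valAnd_update hCe hCf he hf hpe hpf using 3

end Sums

end Problem

end ZonePort

end PercRepro
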